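import Summits.CriticalPhenomena.PercolationContinuityZ3.Theorems.PercNearOneGluingNoHeavyLowerTailSahiOneStepProfileGrid
import Summits.CriticalPhenomena.PercolationContinuityZ3.Theorems.PercNearOneGluingNoHeavyLowerTailSahiOneStepTwoChainCube
import HarnessLib

/-!
# One-step scheme: `(2′)` and Kahn C5 / Sahi `C₃` for an OR OF THRESHOLDS OF DISJOINT BLOCKS against an ARBITRARY increasing event

Prover prim-ineq-prove-3 gen 44 (`--supports stmt-CriticalPhenomena-4575`; paper proof gen 43, `run/shared/lean/prim/prim-ineq-prove-3/
PROOF-G43-DISJOINT-OR.md`, simplified: memo `FINDING-G44-DISJOINT-OR-LEAN.md`).  No sorries.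
**`osN_threshold_disjointOr_nonneg`**: for every product measure, every block `F`, every `t`, every finite family of pairwise DISJOINT
`S_j ⊆ F` with thresholds `r_j`, and EVERY increasing `U`: `0 ≤ n(1_U, 1_B)` at the slot `{N_F ≥ t}`, `B = ⋃_j {N_{S_j} ≥ r_j}` (e.g. every
read-once monotone DNF `x_{S₁} ∨ … ∨ x_{S_k}`).  With the `(3′)` half: **`sahiE3_threshold_disjointOr_nonneg`** — `0 ≤ E₃(1_{N_F ≥ t}, 1_U, 1_B)`.
New beyond the tree: `k ≥ 3` blocks of size `≥ 2` (two monomials = gen-37 2-CNF, one block = gen-20 THEOREM A, `|F| ≤ 6` = gen 16).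
PROOF: push forward to the PROFILE GRID (blocks `R = F ∖ ⋃ S_j` and the `S_j`, index `Option κ₀`); block-count laws are `PF₂`
(`isLogConcaveSeq_real_layer`: one-coordinate recursion = convolution with a Bernoulli weight); `u(v) = μ(U ∩ {profile = v})` satisfies the
one-coordinate cross inequalities (`real_inter_inter_layer_mul_le`); cells are product sets; the five measures of `osN_ind_ind` are grid sums;
conclude by `ProfileGrid.grid_osN_nonneg` (coupling + Harris + Efron).
-/

noncomputable section

namespace Summit.CriticalPhenomena.PercolationContinuityZ3.Theorems

namespace SahiOneStep

open MeasureTheory Finset Function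
open Literature.Probability.Percolation (DeterminedBy determinedBy_iff prodBernoulli_real_eq_sum_weight_ind)
open Literature.Probability.LatticeModels (prodBernoulli sahiE3 prodBernoulli_real_inter_of_determinedBy_disjoint
  prodBernoulli_real_inter_biInter_of_determinedBy)
open Literature.Probability.Percolation.DecisionTree (ind ind_of_mem ind_of_not_mem ind_nonneg)
open Literature.Probability.Percolation.BHK2006 (weight weight_nonneg)
open Literature.Probability.Distributions (IsLogConcaveSeq seqConv seqConv_def isLogConcaveSeq_seqConv
  isLogConcaveSeq_of_support_subset_zero_one isLogConcaveSeq_delta piWeight blockSum)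
open Literature.Combinatorics.Sahi2008 (ex bernoulliWeight ex_bernoulliWeight_ind)
open scoped Classical

variable {ι : Type*} [Fintype ι] [DecidableEq ι]

/-! ## Block-count laws are `PF₂` (Poisson-binomial) -/

omit [Fintype ι] in
/-- `#(insert e F ∩ insert e ω) = #(F ∩ ω) + 1` for `e ∉ F` (with the file's decidability instances). [folklore] -/
theorem card_filter_insert_mem_insert {F : Finset ι} {e : ι} (he : e ∉ F) (ω : Set ι)
    [DecidablePred (· ∈ insert e ω)] [DecidablePred (· ∈ ω)] :
    ((insert e F).filter (· ∈ insert e ω)).card = (F.filter (· ∈ ω)).card + 1 := by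
  rw [Finset.filter_insert, if_pos (Set.mem_insert e ω)]
  have hF : (F.filter (· ∈ insert e ω)) = F.filter (· ∈ ω) := by
    ext i
    simp only [Finset.mem_filter, Set.mem_insert_iff, and_congr_right_iff]
    intro hi
    constructor
    · rintro (rfl | h)
      · exact absurd hi he
      · exact h
    · exact fun h => Or.inr h
  rw [hF, Finset.card_insert_of_notMem]
  exact fun h => he (Finset.mem_filter.1 h).1

omit [Fintype ι] in
/-- `#(insert e F ∩ (ω ∖ {e})) = #(F ∩ ω)` for `e ∉ F` (with the file's decidability instances). [folklore] -/
theorem card_filter_insert_sdiff_singleton {F : Finset ι} {e : ι} (he : e ∉ F) (ω : Set ι)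
    [DecidablePred (· ∈ ω \ {e})] [DecidablePred (· ∈ ω)] :
    ((insert e F).filter (· ∈ ω \ {e})).card = (F.filter (· ∈ ω)).card := by
  rw [Finset.filter_insert, if_neg (fun h : e ∈ ω \ {e} => h.2 rfl)]
  congr 1
  ext i
  simp only [Finset.mem_filter, Set.mem_sdiff_singleton, and_congr_right_iff]
  intro hi
  exact ⟨fun h => h.1, fun h => ⟨h, fun hie => he (hie ▸ hi)⟩⟩

/-- Layer recursion: the layer law of `F ∪ {e}` is that of `F` convolved with the Bernoulli weight `(1 − p_e, p_e)` (`e ∉ F`). [folklore] -/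
theorem real_layer_insert_eq_seqConv (p : ι → unitInterval) {F : Finset ι} {e : ι} (he : e ∉ F) (n : ℕ) :
    (prodBernoulli p).real {ω : Set ι | ((insert e F).filter (· ∈ ω)).card = n} =
      seqConv (fun k => if k = 0 then 1 - (p e : ℝ) else if k = 1 then (p e : ℝ) else 0)
        (fun m => (prodBernoulli p).real {ω : Set ι | (F.filter (· ∈ ω)).card = m}) n := by
  rw [← ex_bernoulliWeight_ind, SahiCdd.ex_split p e]
  have h1 : (fun ω : Set ι => ind {ω : Set ι | ((insert e F).filter (· ∈ ω)).card = n} (insert e ω)) =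
      ind {ω : Set ι | (F.filter (· ∈ ω)).card + 1 = n} := by
    funext ω
    by_cases h : (F.filter (· ∈ ω)).card + 1 = n
    · rw [ind_of_mem (show ω ∈ {ω : Set ι | (F.filter (· ∈ ω)).card + 1 = n} from h),
        ind_of_mem (show insert e ω ∈ {ω : Set ι | ((insert e F).filter (· ∈ ω)).card = n} from by
          rw [Set.mem_setOf_eq, card_filter_insert_mem_insert he]; exact h)]
    · rw [ind_of_not_mem (show ω ∉ {ω : Set ι | (F.filter (· ∈ ω)).card + 1 = n} from h),
        ind_of_not_mem (show insert e ω ∉ {ω : Set ι | ((insert e F).filter (· ∈ ω)).card = n} from by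
          rw [Set.mem_setOf_eq, card_filter_insert_mem_insert he]; exact h)]
  have h2 : (fun ω : Set ι => ind {ω : Set ι | ((insert e F).filter (· ∈ ω)).card = n} (ω \ {e})) =
      ind {ω : Set ι | (F.filter (· ∈ ω)).card = n} := by
    funext ω
    by_cases h : (F.filter (· ∈ ω)).card = n
    · rw [ind_of_mem (show ω ∈ {ω : Set ι | (F.filter (· ∈ ω)).card = n} from h),
        ind_of_mem (show ω \ {e} ∈ {ω : Set ι | ((insert e F).filter (· ∈ ω)).card = n} from by
          rw [Set.mem_setOf_eq, card_filter_insert_sdiff_singleton he]; exact h)]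
    · rw [ind_of_not_mem (show ω ∉ {ω : Set ι | (F.filter (· ∈ ω)).card = n} from h),
        ind_of_not_mem (show ω \ {e} ∉ {ω : Set ι | ((insert e F).filter (· ∈ ω)).card = n} from by
          rw [Set.mem_setOf_eq, card_filter_insert_sdiff_singleton he]; exact h)]
  rw [h1, h2, ex_bernoulliWeight_ind, ex_bernoulliWeight_ind, seqConv_def]
  -- evaluate the two-point convolution
  rcases Nat.eq_zero_or_pos n with rfl | hn
  · have hempty : {ω : Set ι | (F.filter (· ∈ ω)).card + 1 = 0} = ∅ := by
      ext ω; simp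
    rw [hempty, measureReal_empty, mul_zero, zero_add, sum_range_one]
    simp
  · obtain ⟨m, rfl⟩ : ∃ m, n = m + 1 := ⟨n - 1, by omega⟩
    have hset : {ω : Set ι | (F.filter (· ∈ ω)).card + 1 = m + 1} = {ω : Set ι | (F.filter (· ∈ ω)).card = m} := by
      ext ω; simp
    rw [hset, sum_range_succ', sum_range_succ', sum_eq_zero (fun k hk => by
      rw [if_neg (by omega), if_neg (by omega), zero_mul])]
    rw [zero_add, if_pos rfl, Nat.sub_zero, zero_add, if_neg (by omega), if_pos rfl, show m + 1 - 1 = m from by omega,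
      add_comm]

/-- **Block-count laws (Poisson-binomials) are `PF₂`**: `n ↦ μ{N_F = n}` is an `IsLogConcaveSeq`. [folklore] -/
theorem isLogConcaveSeq_real_layer (p : ι → unitInterval) (F : Finset ι) :
    IsLogConcaveSeq (fun n => (prodBernoulli p).real {ω : Set ι | (F.filter (· ∈ ω)).card = n}) := by
  induction F using Finset.induction_on with
  | empty =>
    have e : (fun n => (prodBernoulli p).real {ω : Set ι | ((∅ : Finset ι).filter (· ∈ ω)).card = n}) =
        fun n => if n = 0 then (1 : ℝ) else 0 := by
      funext n
      by_cases hn : n = 0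
      · subst hn
        rw [if_pos rfl, show {ω : Set ι | ((∅ : Finset ι).filter (· ∈ ω)).card = 0} = Set.univ from by ext ω; simp]
        simp
      · rw [if_neg hn, show {ω : Set ι | ((∅ : Finset ι).filter (· ∈ ω)).card = n} = ∅ from by
          ext ω; simp only [Finset.filter_empty, Finset.card_empty, Set.mem_setOf_eq, Set.mem_empty_iff_false, iff_false]
          exact fun h => hn h.symm]
        simp
    rw [e]; exact isLogConcaveSeq_delta zero_le_one
  | insert e F he ih =>
    have e1 : (fun n => (prodBernoulli p).real {ω : Set ι | ((insert e F).filter (· ∈ ω)).card = n}) =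
        seqConv (fun k => if k = 0 then 1 - (p e : ℝ) else if k = 1 then (p e : ℝ) else 0)
          (fun m => (prodBernoulli p).real {ω : Set ι | (F.filter (· ∈ ω)).card = m}) :=
      funext fun n => real_layer_insert_eq_seqConv p he n
    rw [e1]
    refine isLogConcaveSeq_seqConv (isLogConcaveSeq_of_support_subset_zero_one (fun k => ?_) (fun k hk => ?_)) ih
    · have h0 := (p e).2.1; have h1 := (p e).2.2
      split_ifs <;> linarith
    · rw [if_neg (by omega), if_neg (by omega)]

/-! ## Profiles of a disjoint block family -/

section Profile

variable {κ : Type*} [Fintype κ] [DecidableEq κ]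

/-- The profile `v_j = N_{blk j}(ω)` of a configuration, as an element of the grid `κ → Fin (N+1)` (`|blk j| ≤ N`). [this work] -/
def prof (blk : κ → Finset ι) (N : ℕ) (hblk : ∀ j, (blk j).card ≤ N) (ω : Set ι) : κ → Fin (N + 1) := fun j =>
  ⟨((blk j).filter (· ∈ ω)).card, Nat.lt_succ_of_le ((card_filter_le _ _).trans (hblk j))⟩

omit [Fintype ι] [DecidableEq ι] [Fintype κ] [DecidableEq κ] in
/-- Value of the profile. [this work] -/
@[simp] theorem prof_val (blk : κ → Finset ι) (N : ℕ) (hblk : ∀ j, (blk j).card ≤ N) (ω : Set ι) (j : κ) :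
    (prof blk N hblk ω j : ℕ) = ((blk j).filter (· ∈ ω)).card := rfl

omit [Fintype ι] [DecidableEq ι] [DecidableEq κ] in
/-- The cell `{profile = v}` is the intersection of the block layers. [this work] -/
theorem setOf_prof_eq (blk : κ → Finset ι) (N : ℕ) (hblk : ∀ j, (blk j).card ≤ N) (v : κ → Fin (N + 1)) :
    {ω : Set ι | prof blk N hblk ω = v} = ⋂ j ∈ (univ : Finset κ), {ω : Set ι | ((blk j).filter (· ∈ ω)).card = (v j : ℕ)} := by
  ext ω
  simp only [Set.mem_setOf_eq, mem_univ, Set.mem_iInter, true_implies, funext_iff, Fin.ext_iff, prof_val]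

omit [DecidableEq ι] in
/-- **Cell decomposition of a measure along the profile**: `μ(X) = Σ_v μ(X ∩ {profile = v})`. [this work] -/
theorem real_eq_sum_prof (p : ι → unitInterval) (blk : κ → Finset ι) (N : ℕ) (hblk : ∀ j, (blk j).card ≤ N) (X : Set (Set ι)) :
    (prodBernoulli p).real X = ∑ v : κ → Fin (N + 1), (prodBernoulli p).real (X ∩ {ω : Set ι | prof blk N hblk ω = v}) := by
  simp_rw [prodBernoulli_real_eq_sum_weight_ind]
  rw [sum_comm]
  refine Fintype.sum_congr _ _ fun ω => ?_
  rw [← mul_sum]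
  congr 1
  rw [Fintype.sum_eq_single (prof blk N hblk ω) (fun v hv => ind_of_not_mem fun h => hv h.2.symm)]
  by_cases hX : ω ∈ X
  · rw [ind_of_mem hX, ind_of_mem (show ω ∈ X ∩ {ω' : Set ι | prof blk N hblk ω' = prof blk N hblk ω} from ⟨hX, rfl⟩)]
  · rw [ind_of_not_mem hX, ind_of_not_mem fun h => hX h.1]

omit [Fintype ι] [DecidableEq ι] [Fintype κ] [DecidableEq κ] in
/-- On a cell, a profile-measurable event is all or nothing: `μ(E ∩ X ∩ cell) = 1[P v]·μ(X ∩ cell)`. [this work] -/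
theorem real_inter_prof_eq_ite (p : ι → unitInterval) (blk : κ → Finset ι) (N : ℕ) (hblk : ∀ j, (blk j).card ≤ N)
    {E X : Set (Set ι)} (P : (κ → Fin (N + 1)) → Prop) [DecidablePred P] (hE : ∀ ω, ω ∈ E ↔ P (prof blk N hblk ω))
    (v : κ → Fin (N + 1)) :
    (prodBernoulli p).real (E ∩ X ∩ {ω : Set ι | prof blk N hblk ω = v}) =
      if P v then (prodBernoulli p).real (X ∩ {ω : Set ι | prof blk N hblk ω = v}) else 0 := by
  by_cases hP : P v
  · rw [if_pos hP]; congr 1; ext ω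
    simp only [Set.mem_inter_iff, Set.mem_setOf_eq]
    constructor
    · rintro ⟨⟨_, hX⟩, hv⟩; exact ⟨hX, hv⟩
    · rintro ⟨hX, hv⟩; exact ⟨⟨(hE ω).2 (hv ▸ hP), hX⟩, hv⟩
  · rw [if_neg hP]
    have : E ∩ X ∩ {ω : Set ι | prof blk N hblk ω = v} = ∅ := by
      ext ω
      simp only [Set.mem_inter_iff, Set.mem_setOf_eq, Set.mem_empty_iff_false, iff_false]
      rintro ⟨⟨hω, _⟩, hv⟩; exact hP (hv ▸ (hE ω).1 hω)
    rw [this, measureReal_empty]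

omit [DecidableEq ι] [DecidableEq κ] in
/-- **Cells are product sets**: for pairwise disjoint blocks, `μ{profile = v} = Π_j μ{N_{blk j} = v_j}`. [this work] -/
theorem real_prof_eq_prod (p : ι → unitInterval) (blk : κ → Finset ι) (hdisj : ∀ j j', j ≠ j' → Disjoint (blk j) (blk j'))
    (N : ℕ) (hblk : ∀ j, (blk j).card ≤ N) (v : κ → Fin (N + 1)) :
    (prodBernoulli p).real {ω : Set ι | prof blk N hblk ω = v} =
      ∏ j, (prodBernoulli p).real {ω : Set ι | ((blk j).filter (· ∈ ω)).card = (v j : ℕ)} := by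
  have h := prodBernoulli_real_inter_biInter_of_determinedBy p (univ : Finset κ) blk
    (fun j _ j' _ hjj' => hdisj j j' hjj') (C := fun j => {ω : Set ι | ((blk j).filter (· ∈ ω)).card = (v j : ℕ)})
    (fun j _ => determinedBy_layer (blk j) (v j)) (fun _ _ => MeasurableSet.of_discrete)
    (A := Set.univ) (Literature.Probability.Percolation.determinedBy_univ _) MeasurableSet.univ
  rw [Set.univ_inter, probReal_univ, one_mul] at h
  rw [setOf_prof_eq, h]

omit [DecidableEq ι] [Fintype κ] in
/-- **One-coordinate cross inequality for `u(v) = μ(U ∩ {profile = v})`** (layer monotonicity with a foreign factor):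
`u(v with v_j := x)·μ{N_{blk j} = x'} ≤ u(v with v_j := x')·μ{N_{blk j} = x}` for `x ≤ x'` and `U` increasing. [this work] -/
theorem real_inter_prof_update_mul_le (p : ι → unitInterval) (blk : κ → Finset ι) (hdisj : ∀ j j', j ≠ j' → Disjoint (blk j) (blk j'))
    (N : ℕ) (hblk : ∀ j, (blk j).card ≤ N) {U : Set (Set ι)} (hU : IsUpperSet U) (v : κ → Fin (N + 1)) (j : κ)
    {x x' : Fin (N + 1)} (hxx' : x ≤ x') :
    (prodBernoulli p).real (U ∩ {ω : Set ι | prof blk N hblk ω = update v j x}) *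
        (prodBernoulli p).real {ω : Set ι | ((blk j).filter (· ∈ ω)).card = (x' : ℕ)} ≤
      (prodBernoulli p).real (U ∩ {ω : Set ι | prof blk N hblk ω = update v j x'}) *
        (prodBernoulli p).real {ω : Set ι | ((blk j).filter (· ∈ ω)).card = (x : ℕ)} := by
  set C : Set (Set ι) := {ω : Set ι | ∀ i, i ≠ j → ((blk i).filter (· ∈ ω)).card = (v i : ℕ)} with hC
  have hCdet : DeterminedBy C ((↑(blk j) : Set ι)ᶜ) := by
    rw [determinedBy_iff]
    intro ω ω' h
    simp only [hC, Set.mem_setOf_eq]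
    refine forall₂_congr fun i hi => ?_
    have hsub : (↑(blk i) : Set ι) ⊆ (↑(blk j) : Set ι)ᶜ := fun a ha hja =>
      Finset.disjoint_left.1 (hdisj i j hi) (Finset.mem_coe.1 ha) (Finset.mem_coe.1 hja)
    have hi' := (determinedBy_iff _ _).1 ((determinedBy_layer (blk i) (v i : ℕ)).mono hsub) ω ω' h
    simp only [Set.mem_setOf_eq] at hi'
    rw [hi']
  have hcell : ∀ y : Fin (N + 1), U ∩ {ω : Set ι | prof blk N hblk ω = update v j y} =
      U ∩ C ∩ {ω : Set ι | ((blk j).filter (· ∈ ω)).card = (y : ℕ)} := by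
    intro y; ext ω
    simp only [Set.mem_inter_iff, Set.mem_setOf_eq, hC, funext_iff, Fin.ext_iff, prof_val]
    constructor
    · rintro ⟨hUω, h⟩
      refine ⟨⟨hUω, fun i hi => ?_⟩, ?_⟩
      · have := h i; rwa [update_of_ne hi] at this
      · have := h j; rwa [update_self] at this
    · rintro ⟨⟨hUω, h⟩, hj⟩
      refine ⟨hUω, fun i => ?_⟩
      by_cases hi : i = j
      · subst hi; rwa [update_self]
      · rw [update_of_ne hi]; exact h i hi
  rw [hcell x, hcell x']
  exact real_inter_inter_layer_mul_le p (blk j) hU hCdet (by exact_mod_cast hxx')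

end Profile

/-! ## THE THEOREM -/

/-- **`(2′)` FOR AN OR OF THRESHOLDS OF DISJOINT BLOCKS.**  For every product measure, every block `F`, every `t`, every finite family of
pairwise disjoint `S_j ⊆ F` with thresholds `r_j`, and EVERY increasing event `U`:
`0 ≤ n(1_U, 1_B)` at the first slot `H = {N_F ≥ t}`, `B = {ω : ∃ j, r_j ≤ N_{S_j}(ω)}`. [this work] -/
theorem osN_threshold_disjointOr_nonneg (p : ι → unitInterval) (F : Finset ι) (t : ℕ) {κ₀ : Type*} [Fintype κ₀] [DecidableEq κ₀]
    (S : κ₀ → Finset ι) (hSF : ∀ j, S j ⊆ F) (hdisj : ∀ j j', j ≠ j' → Disjoint (S j) (S j')) (r : κ₀ → ℕ)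
    {U : Set (Set ι)} (hU : IsUpperSet U) :
    0 ≤ osN p {ω : Set ι | t ≤ (F.filter (· ∈ ω)).card} (ind U)
      (ind {ω : Set ι | ∃ j, r j ≤ ((S j).filter (· ∈ ω)).card}) := by
  set N : ℕ := F.card with hN
  set blk : Option κ₀ → Finset ι := fun j => Option.elim j (F \ univ.biUnion S) S with hblk
  have hblkF : ∀ j, blk j ⊆ F := fun j => by
    cases j with
    | none => exact sdiff_subset
    | some j => exact hSF j
  have hblkN : ∀ j, (blk j).card ≤ N := fun j => card_le_card (hblkF j)
  have hblkdisj : ∀ j j', j ≠ j' → Disjoint (blk j) (blk j') := by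
    intro j j' hjj'
    cases j with
    | none =>
      cases j' with
      | none => exact absurd rfl hjj'
      | some b => exact Finset.sdiff_disjoint.mono_right (subset_biUnion_of_mem S (mem_univ b))
    | some a =>
      cases j' with
      | none => exact (Finset.sdiff_disjoint.mono_right (subset_biUnion_of_mem S (mem_univ a))).symm
      | some b => exact hdisj a b (fun h => hjj' (by rw [h]))
  have hFeq : F = univ.biUnion blk := by
    ext i
    simp only [mem_biUnion, mem_univ, true_and]
    constructor
    · intro hi
      by_cases h : ∃ j, i ∈ S j
      · obtain ⟨j, hj⟩ := h; exact ⟨some j, hj⟩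
      · refine ⟨none, ?_⟩
        show i ∈ F \ univ.biUnion S
        rw [mem_sdiff, mem_biUnion]; exact ⟨hi, fun ⟨j, _, hj⟩ => h ⟨j, hj⟩⟩
    · rintro ⟨j, hj⟩; exact hblkF j hj
  have hcardF : ∀ ω : Set ι, (F.filter (· ∈ ω)).card = ∑ j, ((blk j).filter (· ∈ ω)).card := by
    intro ω
    rw [hFeq, filter_biUnion, card_biUnion]
    intro j _ j' _ hjj'
    exact disjoint_filter_filter (hblkdisj j j' hjj')
  set φ : Option κ₀ → ℕ → ℝ := fun j n => (prodBernoulli p).real {ω : Set ι | ((blk j).filter (· ∈ ω)).card = n} with hφ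
  set r' : Option κ₀ → ℕ := fun j => Option.elim j (N + 1) r with hr'
  set u : (Option κ₀ → Fin (N + 1)) → ℝ := fun v => (prodBernoulli p).real (U ∩ {ω : Set ι | prof blk N hblkN ω = v}) with hu
  have hφlc : ∀ j, IsLogConcaveSeq (φ j) := fun j => isLogConcaveSeq_real_layer p (blk j)
  have hφ1 : ∀ j, ∑ n : Fin (N + 1), φ j n = 1 := by
    intro j
    rw [Fin.sum_univ_eq_sum_range (fun n => φ j n) (N + 1), ← sum_real_layer_eq_one p (blk j),
      ← sum_range_add_sum_Ico _ (show (blk j).card + 1 ≤ N + 1 by have := hblkN j; omega)]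
    rw [sum_eq_zero (s := Ico ((blk j).card + 1) (N + 1)) (fun n hn => by
      have hn' := (mem_Ico.1 hn).1
      simp only [hφ]
      rw [show {ω : Set ι | ((blk j).filter (· ∈ ω)).card = n} = ∅ from by
        ext ω; simp only [Set.mem_setOf_eq, Set.mem_empty_iff_false, iff_false]
        intro h; have := card_filter_le (blk j) (· ∈ ω); omega]
      exact measureReal_empty), add_zero]
  have hu0 : ∀ v, 0 ≤ u v := fun v => measureReal_nonneg
  have hcell : ∀ v : Option κ₀ → Fin (N + 1), (prodBernoulli p).real {ω : Set ι | prof blk N hblkN ω = v} = piWeight N φ v :=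
    fun v => real_prof_eq_prod p blk hblkdisj N hblkN v
  have huΦ : ∀ v, u v ≤ piWeight N φ v := fun v => by
    rw [← hcell]; exact measureReal_mono Set.inter_subset_right
  have hmono : ∀ v j (x x' : Fin (N + 1)), x ≤ x' → u (update v j x) * φ j x' ≤ u (update v j x') * φ j x :=
    fun v j x x' hxx' => real_inter_prof_update_mul_le p blk hblkdisj N hblkN hU v j hxx'
  have hgrid := ProfileGrid.grid_osN_nonneg φ hφlc hφ1 r' t u hu0 huΦ hmono
  set H : Set (Set ι) := {ω : Set ι | t ≤ (F.filter (· ∈ ω)).card} with hH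
  set B : Set (Set ι) := {ω : Set ι | ∃ j, r j ≤ ((S j).filter (· ∈ ω)).card} with hB
  have memH : ∀ ω : Set ι, ω ∈ H ↔ t ≤ blockSum univ (prof blk N hblkN ω) := fun ω => by
    rw [hH, Set.mem_setOf_eq, hcardF ω, blockSum]; simp only [prof_val]
  have memB : ∀ ω : Set ι, ω ∈ B ↔ ∃ j, r' j ≤ (prof blk N hblkN ω j : ℕ) := fun ω => by
    rw [hB, Set.mem_setOf_eq]
    constructor
    · rintro ⟨j, hj⟩; exact ⟨some j, by simpa [hr', hblk, prof_val] using hj⟩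
    · rintro ⟨j, hj⟩
      cases j with
      | none =>
        exfalso
        have h1 : (prof blk N hblkN ω none : ℕ) ≤ N := Nat.lt_succ_iff.1 (prof blk N hblkN ω none).2
        simp only [hr', Option.elim] at hj; omega
      | some j => exact ⟨j, by simpa [hr', hblk, prof_val] using hj⟩
  have memHB : ∀ ω : Set ι, ω ∈ H ∩ B ↔
      t ≤ blockSum univ (prof blk N hblkN ω) ∧ ∃ j, r' j ≤ (prof blk N hblkN ω j : ℕ) := fun ω => by
    rw [Set.mem_inter_iff, memH, memB]
  -- the five measures as grid sums
  have eHU : (prodBernoulli p).real (H ∩ U) =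
      ∑ v : Option κ₀ → Fin (N + 1), if t ≤ blockSum univ v then u v else 0 := by
    rw [real_eq_sum_prof p blk N hblkN]
    exact Fintype.sum_congr _ _ fun v =>
      real_inter_prof_eq_ite p blk N hblkN (E := H) (X := U) (fun v => t ≤ blockSum univ v) memH v
  have eHB : (prodBernoulli p).real (H ∩ B) =
      ∑ v : Option κ₀ → Fin (N + 1), if t ≤ blockSum univ v ∧ (∃ j, r' j ≤ (v j : ℕ)) then piWeight N φ v else 0 := by
    rw [real_eq_sum_prof p blk N hblkN]
    refine Fintype.sum_congr _ _ fun v => ?_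
    rw [← Set.inter_univ (H ∩ B), real_inter_prof_eq_ite p blk N hblkN (E := H ∩ B) (X := Set.univ)
      (fun v => t ≤ blockSum univ v ∧ ∃ j, r' j ≤ (v j : ℕ)) memHB v, Set.univ_inter, hcell]
  have eH : (prodBernoulli p).real H = ∑ v : Option κ₀ → Fin (N + 1), if t ≤ blockSum univ v then piWeight N φ v else 0 := by
    rw [real_eq_sum_prof p blk N hblkN]
    refine Fintype.sum_congr _ _ fun v => ?_
    rw [← Set.inter_univ H, real_inter_prof_eq_ite p blk N hblkN (E := H) (X := Set.univ) (fun v => t ≤ blockSum univ v) memH v,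
      Set.univ_inter, hcell]
  have eHUB : (prodBernoulli p).real (H ∩ U ∩ B) =
      ∑ v : Option κ₀ → Fin (N + 1), if t ≤ blockSum univ v ∧ (∃ j, r' j ≤ (v j : ℕ)) then u v else 0 := by
    rw [show H ∩ U ∩ B = (H ∩ B) ∩ U from by rw [Set.inter_assoc, Set.inter_comm U B, ← Set.inter_assoc],
      real_eq_sum_prof p blk N hblkN]
    exact Fintype.sum_congr _ _ fun v => real_inter_prof_eq_ite p blk N hblkN (E := H ∩ B) (X := U)
      (fun v => t ≤ blockSum univ v ∧ ∃ j, r' j ≤ (v j : ℕ)) memHB v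
  have eU : (prodBernoulli p).real U = ∑ v : Option κ₀ → Fin (N + 1), u v := real_eq_sum_prof p blk N hblkN U
  have eB : (prodBernoulli p).real B = ∑ v : Option κ₀ → Fin (N + 1), if (∃ j, r' j ≤ (v j : ℕ)) then piWeight N φ v else 0 := by
    rw [real_eq_sum_prof p blk N hblkN]
    refine Fintype.sum_congr _ _ fun v => ?_
    rw [← Set.inter_univ B, real_inter_prof_eq_ite p blk N hblkN (E := B) (X := Set.univ) (fun v => ∃ j, r' j ≤ (v j : ℕ)) memB v,
      Set.univ_inter, hcell]
  rw [osN_ind_ind, eHU, eHB, eH, eHUB, eU, eB]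
  exact hgrid

omit [Fintype ι] [DecidableEq ι] in
/-- An OR of block thresholds is increasing. [folklore] -/
theorem isUpperSet_disjointOr {κ₀ : Type*} (S : κ₀ → Finset ι) (r : κ₀ → ℕ) :
    IsUpperSet {ω : Set ι | ∃ j, r j ≤ ((S j).filter (· ∈ ω)).card} := by
  intro ω ω' hle
  rintro ⟨j, hj⟩
  exact ⟨j, hj.trans (card_le_card fun i hi => by rw [mem_filter] at hi ⊢; exact ⟨hi.1, hle hi.2⟩)⟩

/-- **KAHN C5 / SAHI `C₃` for a Hamming threshold, an OR of thresholds of disjoint blocks (e.g. a read-once monotone DNF) and an arbitrary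
increasing event**, every product measure: `0 ≤ E₃(1_{N_F ≥ t}, 1_U, 1_{⋃_j {N_{S_j} ≥ r_j}})`. [this work] -/
theorem sahiE3_threshold_disjointOr_nonneg (p : ι → unitInterval) (F : Finset ι) (t : ℕ) {κ₀ : Type*} [Fintype κ₀] [DecidableEq κ₀]
    (S : κ₀ → Finset ι) (hSF : ∀ j, S j ⊆ F) (hdisj : ∀ j j', j ≠ j' → Disjoint (S j) (S j')) (r : κ₀ → ℕ)
    {U : Set (Set ι)} (hU : IsUpperSet U) :
    0 ≤ sahiE3 (prodBernoulli p) {ω : Set ι | t ≤ (F.filter (· ∈ ω)).card} U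
      {ω : Set ι | ∃ j, r j ≤ ((S j).filter (· ∈ ω)).card} := by
  have hB := isUpperSet_disjointOr S r
  rw [← osT_ind_ind, osT_eq_osMp_add_osN]
  exact add_nonneg (osMp_threshold_nonneg_all p F t hU hB) (osN_threshold_disjointOr_nonneg p F t S hSF hdisj r hU)

/-- The same with the two slots exchanged: `0 ≤ E₃(1_{N_F ≥ t}, 1_B, 1_U)`. [this work] -/
theorem sahiE3_threshold_disjointOr_nonneg' (p : ι → unitInterval) (F : Finset ι) (t : ℕ) {κ₀ : Type*} [Fintype κ₀] [DecidableEq κ₀]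
    (S : κ₀ → Finset ι) (hSF : ∀ j, S j ⊆ F) (hdisj : ∀ j j', j ≠ j' → Disjoint (S j) (S j')) (r : κ₀ → ℕ)
    {U : Set (Set ι)} (hU : IsUpperSet U) :
    0 ≤ sahiE3 (prodBernoulli p) {ω : Set ι | t ≤ (F.filter (· ∈ ω)).card}
      {ω : Set ι | ∃ j, r j ≤ ((S j).filter (· ∈ ω)).card} U := by
  have hB := isUpperSet_disjointOr S r
  rw [← osT_ind_ind, osT_eq_osMp_add_osN, osN_comm]
  exact add_nonneg (osMp_threshold_nonneg_all p F t hB hU) (osN_threshold_disjointOr_nonneg p F t S hSF hdisj r hU)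

end SahiOneStep

end Summit.CriticalPhenomena.PercolationContinuityZ3.Theorems
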